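import Summits.CriticalPhenomena.PercolationContinuityZ3.Theorems.PercNearOneGluingNoHeavyLowerTailNineTypeLabelCert
import HarnessLib

/-!
# The weight-two parts of the primed rows `S3′`, `U′` are PACKED: three new label certificates (all `n`, unconditional)

Support file for crux `stmt-CriticalPhenomena-4575` (master-family programme; packing `U`, its sibling `S3`, Conjecture W), seat `prim-l12-p6` gen 31;
memo `run/shared/lean/prim/prim-l12/FROM-prim-l12-p6-g31-PRIMED-FAMILY.md` §11.  Cells as in `FourPointAtoms.pat4` (`0 ⊥, 1 cy, 2 by, 3 bc, 4 ay, 5 ac,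
6 ab, 7 bcy, 8 ay|bc, 9 ac|by, 10 acy, 11 ab|cy, 12 aby, 13 abc, 14 abcy`).

The memo's primed rows subtract the product `c₈c₉ = P(ay|bc)P(ac|by)` ("the two copies realise the two pairings other than `ab|cy`") from
`prim-bnk-1` gen 34/35's `U`, `S3` and from Conjecture W.  Their DART-FREE (weight-two) parts are label certificates in the sense of
`…NineTypeLabelCert` (`TwoCopyMono.tableOK`, checked by `decide`), hence theorems for every finite weighted graph and all marked points:
* `TwoCopyMono.s3P_weightTwo_pack` — **`c₁c₆ + c₁₁(c₂+c₃+c₄+c₅+c₈+c₉) + c₈c₉ ≤ c₀(c₁₁+c₁₄)`** (certificate: the `ab|cy`-star, `(ac|by ; ay|bc)`,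
  `(ab|c|y ; a|b|cy)` with labels `8,1,1,8,1,8,7,5`): the weight-two part of `S3′ = S3 − c₈c₉`; the full conjecture `S3′ ≥ 0` adds half the eight
  `ab|cy`-crossing darts (`TwoCopyMono.ConjS3Prime` of `…Q44PrimedKernels`);
* `TwoCopyMono.uPR_weightTwo_packAC` — `c₈(c₁+c₂+c₅+c₆+c₉+c₁₁) + c₉c₁₁ ≤ c₀(c₁₁+c₁₄)` (the `ay|bc`-star plus `(ab|cy ; ac|by)`, labels `1,…,1,8`):
  the weight-two part of `U′_R` against the AC-goods (the memo conjectures it against `c₀c₁₄` alone);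
* `TwoCopyMono.e2_pairings_packAC` — **`c₈c₉ + c₈c₁₁ + c₉c₁₁ ≤ c₀(c₁₁+c₁₄)`**: the second elementary symmetric function of the three pairings
  `ab|cy, ac|by, ay|bc` is packed by the goods — the four-point analogue of the pairing structure in Gladkov's three-point strong Harris–Kleitman
  inequality, common core `e₂(c₈,c₉,c₁₁)` of every row of the memo's family (certificate `(ab|cy;ac|by),(ab|cy;ay|bc),(ac|by;ay|bc)`, labels `5,1,8`).
No sorries, no named facts, no new definitions; standard axioms.  Each proof = `pack_of_tableOK` + `decide +kernel`.
-/

namespace Summit.CriticalPhenomena.PercolationContinuityZ3.Theorems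

namespace TwoCopyMono

open Finset FourPointAtoms

variable {n : ℕ}

/-- **The weight-two part of `S3′` is packed** (all `n`): `c₁c₆ + c₁₁(c₂+c₃+c₄+c₅+c₈+c₉) + c₈c₉ ≤ c₀(c₁₁+c₁₄)`. [this work] -/
theorem s3P_weightTwo_pack (w : Sym2 (Fin n) → unitInterval) (a b c y : Fin n) :
    cell w a b c y 11 * cell w a b c y 2 + cell w a b c y 11 * cell w a b c y 3 + cell w a b c y 11 * cell w a b c y 4 + cell w a b c y 11 * cell w a b c y 5 + cell w a b c y 11 * cell w a b c y 8 + cell w a b c y 11 * cell w a b c y 9 + cell w a b c y 9 * cell w a b c y 8 + cell w a b c y 6 * cell w a b c y 1 ≤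
      (cell w a b c y 11 + cell w a b c y 14) * cell w a b c y 0 := by
  have h := pack_of_tableOK ({(11, 2), (11, 3), (11, 4), (11, 5), (11, 8), (11, 9), (9, 8), (6, 1)} : Finset (Fin 15 × Fin 15))
    (fun p => if p = (11, 2) then 8 else if p = (11, 3) then 1 else if p = (11, 4) then 1 else if p = (11, 5) then 8 else if p = (11, 8) then 1 else if p = (11, 9) then 8 else if p = (9, 8) then 7 else 5)
    (by decide +kernel) w a b c y
  rw [Finset.sum_insert (by decide), Finset.sum_insert (by decide), Finset.sum_insert (by decide), Finset.sum_insert (by decide), Finset.sum_insert (by decide), Finset.sum_insert (by decide), Finset.sum_insert (by decide), Finset.sum_singleton] at h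
  dsimp only at h
  linarith

/-- **The weight-two part of `U′_R` against the AC-goods** (all `n`): `c₈(c₁+c₂+c₅+c₆+c₉+c₁₁) + c₉c₁₁ ≤ c₀(c₁₁+c₁₄)`. [this work] -/
theorem uPR_weightTwo_packAC (w : Sym2 (Fin n) → unitInterval) (a b c y : Fin n) :
    cell w a b c y 8 * cell w a b c y 1 + cell w a b c y 8 * cell w a b c y 2 + cell w a b c y 8 * cell w a b c y 5 + cell w a b c y 8 * cell w a b c y 6 + cell w a b c y 8 * cell w a b c y 9 + cell w a b c y 8 * cell w a b c y 11 + cell w a b c y 11 * cell w a b c y 9 ≤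
      (cell w a b c y 11 + cell w a b c y 14) * cell w a b c y 0 := by
  have h := pack_of_tableOK ({(8, 1), (8, 2), (8, 5), (8, 6), (8, 9), (8, 11), (11, 9)} : Finset (Fin 15 × Fin 15))
    (fun p => if p = (8, 1) then 1 else if p = (8, 2) then 1 else if p = (8, 5) then 1 else if p = (8, 6) then 1 else if p = (8, 9) then 1 else if p = (8, 11) then 1 else 8)
    (by decide +kernel) w a b c y
  rw [Finset.sum_insert (by decide), Finset.sum_insert (by decide), Finset.sum_insert (by decide), Finset.sum_insert (by decide), Finset.sum_insert (by decide), Finset.sum_insert (by decide), Finset.sum_singleton] at h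
  dsimp only at h
  linarith

/-- **`e₂` of the three pairings is packed** (all `n`): `c₈c₉ + c₈c₁₁ + c₉c₁₁ ≤ c₀(c₁₁+c₁₄)`. [this work] -/
theorem e2_pairings_packAC (w : Sym2 (Fin n) → unitInterval) (a b c y : Fin n) :
    cell w a b c y 11 * cell w a b c y 9 + cell w a b c y 11 * cell w a b c y 8 + cell w a b c y 9 * cell w a b c y 8 ≤
      (cell w a b c y 11 + cell w a b c y 14) * cell w a b c y 0 := by
  have h := pack_of_tableOK ({(11, 9), (11, 8), (9, 8)} : Finset (Fin 15 × Fin 15))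
    (fun p => if p = (11, 9) then 5 else if p = (11, 8) then 1 else 8)
    (by decide +kernel) w a b c y
  rw [Finset.sum_insert (by decide), Finset.sum_insert (by decide), Finset.sum_singleton] at h
  dsimp only at h
  linarith

end TwoCopyMono

end Summit.CriticalPhenomena.PercolationContinuityZ3.Theorems
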